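import Literature.Topology.FourManifolds.FishtailSection
import Literature.Topology.FourManifolds.FishtailEndModel
import HarnessLib

/-!
# The corridor bend and the trivialisation of the model bundle (fishtail end, corner region)

Two explicit ingredients of the embedding of the fishtail end model (`FishtailEndModel.lean`)
into the straightened Cappell–Shaneson model near the boundary circle `γ` of Gompf's disc
(R. Gompf, *More Cappell–Shaneson spheres are standard*, Algebr. Geom. Topol. 10 (2010),
Lemma 2.2: the end of the fishtail `Φ = N ∪ 2-handle` is the shell of the box `N` union the
boundary of a tubular neighbourhood of the disc `D`, joined around the corner along `γ`):

* `Literature.Topology.FourManifolds.fishBend c p₁ ρ_b` — the **corridor bend**, a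
  diffeomorphism of the plane (composite of two shears) with explicit inverse
  `Literature.Topology.FourManifolds.fishBendInv`: in the coordinates `(W, E)` = (radius of the
  corner chart offset, depth) it is the identity for `p = ρ - ρ_b + e/c ≥ 0` (the shell of the
  box, `fishBend_of_nonneg`) and the map `(ρ, e) ↦ (ρ_b - e/c, c(ρ - ρ_b) + 2e)` for `p ≤ -p₁`
  (`fishBend_of_le`: the tube of radius `ρ_b - e/c` about the disc, going up), with `W ≥ ρ > 0`
  throughout (`le_fishBend_fst`).
* `Literature.Topology.FourManifolds.modelG a′ b′ n_j` — the **real lift of the model clutching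
  function** `g = gompfLift a′ b′` cut at `n_j` (`circleExp_modelG`: it exponentiates to
  `circleMapOfLift g`, the last-coordinate factor of the fishtail monodromy; smooth off the cut),
  smooth off the cut (`contMDiffAt_modelG`), with its plateaus `0` / `2π` beside the cut.

Everything is proved; no named facts.

## References

* R. E. Gompf, *More Cappell–Shaneson spheres are standard*, Algebr. Geom. Topol. 10 (2010)
  1665–1681, Lemma 2.2 and its proof. [GompfAGT2010]
-/

noncomputable section

open scoped Manifold ContDiff Topology Real
open Set Function Complex Filter

namespace Literature.Topology.FourManifolds

/-! ### The corridor bend -/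

section Bend

variable (c p₁ ρb : ℝ)

/-- The bending profile `f(p) = c p λ(-p/p₁)`: `0` for `p ≥ 0`, `c p` for `p ≤ -p₁`. [folklore] -/
def bendF (c p₁ p : ℝ) : ℝ := c * p * Real.smoothTransition (-p / p₁)

/-- **The corridor bend** `(ρ, e) ↦ (W, E) = (ρ - f(p)/c, e + f(p))`, `p = ρ - ρ_b + e/c`:
the composite of the shear `(p, e) ↦ (p, e + f(p))` with the linear shear straightening the
bent leg, written back in `(ρ, e)`. [cite: GompfAGT2010, Lemma 2.2 (proof: ∂Φ, the end of Φ around the corner along γ)] -/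
def fishBend (x : ℝ × ℝ) : ℝ × ℝ :=
  (x.1 - bendF c p₁ (x.1 - ρb + x.2 / c) / c, x.2 + bendF c p₁ (x.1 - ρb + x.2 / c))

/-- **The inverse bend**: `p = W - ρ_b + E/c`, `e = E - f(p)`, `ρ = p + ρ_b - e/c`. [folklore] -/
def fishBendInv (y : ℝ × ℝ) : ℝ × ℝ :=
  let p := y.1 - ρb + y.2 / c
  let e := y.2 - bendF c p₁ p
  (p + ρb - e / c, e)

variable {c p₁ ρb}

/-- For `p ≥ 0` the profile vanishes (`p₁ > 0`). [folklore] -/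
theorem bendF_of_nonneg (hp₁ : 0 < p₁) {p : ℝ} (hp : 0 ≤ p) : bendF c p₁ p = 0 := by
  rw [bendF, Real.smoothTransition.zero_of_nonpos (div_nonpos_of_nonpos_of_nonneg (by linarith) hp₁.le),
    mul_zero]

/-- For `p ≤ -p₁` the profile is `c p`. [folklore] -/
theorem bendF_of_le (hp₁ : 0 < p₁) {p : ℝ} (hp : p ≤ -p₁) : bendF c p₁ p = c * p := by
  rw [bendF, Real.smoothTransition.one_of_one_le (by rw [le_div_iff₀ hp₁]; linarith), mul_one]

/-- `f(p)/c = p λ(-p/p₁) ≤ 0` for `p ≤ 0` and `= 0` for `p ≥ 0`; hence `-f(p)/c ≥ 0` always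
(`c ≠ 0`, `p₁ > 0`). [folklore] -/
theorem bendF_div_nonpos (hc : c ≠ 0) (hp₁ : 0 < p₁) (p : ℝ) : bendF c p₁ p / c ≤ 0 := by
  rw [bendF, show c * p * Real.smoothTransition (-p / p₁) / c = p * Real.smoothTransition (-p / p₁) by
    field_simp]
  rcases le_or_gt p 0 with hp | hp
  · exact mul_nonpos_of_nonpos_of_nonneg hp (Real.smoothTransition.nonneg _)
  · rw [Real.smoothTransition.zero_of_nonpos (div_nonpos_of_nonpos_of_nonneg (by linarith) hp₁.le), mul_zero]

/-- The profile is smooth. [folklore] -/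
theorem contDiff_bendF (c p₁ : ℝ) : ContDiff ℝ ∞ (bendF c p₁) :=
  (contDiff_const.mul contDiff_id).mul (Real.smoothTransition.contDiff.comp (contDiff_neg.div_const _))

/-- **`inverse ∘ bend = id`** (`c ≠ 0`). [folklore] -/
theorem fishBendInv_fishBend (hc : c ≠ 0) (x : ℝ × ℝ) : fishBendInv c p₁ ρb (fishBend c p₁ ρb x) = x := by
  obtain ⟨ρ, e⟩ := x
  have hp : ρ - bendF c p₁ (ρ - ρb + e / c) / c - ρb + (e + bendF c p₁ (ρ - ρb + e / c)) / c =
      ρ - ρb + e / c := by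
    field_simp; ring
  simp only [fishBendInv, fishBend, hp]
  refine Prod.ext ?_ ?_
  · show ρ - ρb + e / c + ρb - (e + bendF c p₁ (ρ - ρb + e / c) - bendF c p₁ (ρ - ρb + e / c)) / c = ρ
    field_simp; ring
  · show e + bendF c p₁ (ρ - ρb + e / c) - bendF c p₁ (ρ - ρb + e / c) = e
    ring

/-- **`bend ∘ inverse = id`** (`c ≠ 0`). [folklore] -/
theorem fishBend_fishBendInv (hc : c ≠ 0) (y : ℝ × ℝ) : fishBend c p₁ ρb (fishBendInv c p₁ ρb y) = y := by
  obtain ⟨W, E⟩ := y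
  have hp : W - ρb + E / c + ρb - (E - bendF c p₁ (W - ρb + E / c)) / c - ρb +
      (E - bendF c p₁ (W - ρb + E / c)) / c = W - ρb + E / c := by
    field_simp; ring
  simp only [fishBend, fishBendInv, hp]
  refine Prod.ext ?_ ?_
  · show W - ρb + E / c + ρb - (E - bendF c p₁ (W - ρb + E / c)) / c - bendF c p₁ (W - ρb + E / c) / c = W
    field_simp; ring
  · show E - bendF c p₁ (W - ρb + E / c) + bendF c p₁ (W - ρb + E / c) = E
    ring

/-- The bend is smooth. [folklore] -/
theorem contDiff_fishBend (c p₁ ρb : ℝ) : ContDiff ℝ ∞ (fishBend c p₁ ρb) := by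
  have hp : ContDiff ℝ ∞ fun x : ℝ × ℝ ↦ x.1 - ρb + x.2 / c :=
    (contDiff_fst.sub contDiff_const).add (contDiff_snd.div_const _)
  have hf : ContDiff ℝ ∞ fun x : ℝ × ℝ ↦ bendF c p₁ (x.1 - ρb + x.2 / c) := (contDiff_bendF c p₁).comp hp
  exact (contDiff_fst.sub (hf.div_const _)).prodMk (contDiff_snd.add hf)

/-- The inverse bend is smooth. [folklore] -/
theorem contDiff_fishBendInv (c p₁ ρb : ℝ) : ContDiff ℝ ∞ (fishBendInv c p₁ ρb) := by
  have hp : ContDiff ℝ ∞ fun y : ℝ × ℝ ↦ y.1 - ρb + y.2 / c :=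
    (contDiff_fst.sub contDiff_const).add (contDiff_snd.div_const _)
  have he : ContDiff ℝ ∞ fun y : ℝ × ℝ ↦ y.2 - bendF c p₁ (y.1 - ρb + y.2 / c) :=
    contDiff_snd.sub ((contDiff_bendF c p₁).comp hp)
  exact ((hp.add contDiff_const).sub (he.div_const _)).prodMk he

/-- **The box leg**: for `p = ρ - ρ_b + e/c ≥ 0` the bend is the identity. [folklore] -/
theorem fishBend_of_nonneg (hp₁ : 0 < p₁) {x : ℝ × ℝ} (hx : 0 ≤ x.1 - ρb + x.2 / c) :
    fishBend c p₁ ρb x = x := by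
  obtain ⟨ρ, e⟩ := x
  simp only [fishBend, bendF_of_nonneg hp₁ hx, zero_div, sub_zero, add_zero]

/-- **The handle leg**: for `p ≤ -p₁` the bend is `(ρ_b - e/c, c(ρ - ρ_b) + 2e)` (`c ≠ 0`). [folklore] -/
theorem fishBend_of_le (hc : c ≠ 0) (hp₁ : 0 < p₁) {x : ℝ × ℝ} (hx : x.1 - ρb + x.2 / c ≤ -p₁) :
    fishBend c p₁ ρb x = (ρb - x.2 / c, c * (x.1 - ρb) + 2 * x.2) := by
  obtain ⟨ρ, e⟩ := x
  simp only [fishBend, bendF_of_le hp₁ hx]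
  refine Prod.ext ?_ ?_
  · show ρ - c * (ρ - ρb + e / c) / c = ρb - e / c
    field_simp; ring
  · show e + c * (ρ - ρb + e / c) = c * (ρ - ρb) + 2 * e
    field_simp; ring

/-- **The radius never drops**: `ρ ≤ W` (`c ≠ 0`, `p₁ > 0`); in particular `W > 0` when `ρ > 0`,
so the corridor stays off the disc `{w = 0}`. [folklore] -/
theorem le_fishBend_fst (hc : c ≠ 0) (hp₁ : 0 < p₁) (x : ℝ × ℝ) : x.1 ≤ (fishBend c p₁ ρb x).1 := by
  have h := bendF_div_nonpos (c := c) hc hp₁ (x.1 - ρb + x.2 / c)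
  simp only [fishBend]
  linarith

end Bend

/-! ### The real lift of the model clutching function and the trivialising factor -/

section Triv

variable (a' b' nj : ℝ)

/-- **The real lift of the model clutching function cut at `n_j`**:
`g̃(z) = gompfLift a′ b′ (argCut n_j z)`. [cite: GompfAGT2010, Lemma 2.2 (proof: the monodromy ψ of ∂Φ is the Dehn twist δ_α)] -/
def modelG (z : Circle) : ℝ := gompfLift a' b' (argCut nj z)

variable {a' b' nj}

/-- **The lift exponentiates to the clutching map**: `e^{i g̃(z)} = circleMapOfLift g z`. [folklore] -/
theorem circleExp_modelG (z : Circle) :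
    Circle.exp (modelG a' b' nj z) = circleMapOfLift (gompfLift a' b') z := by
  conv_rhs => rw [← circleExp_argCut nj z]
  rw [modelG, circleMapOfLift_exp (k := 1) (fun θ ↦ by rw [gompfLift_add_two_pi]; push_cast; ring)]

/-- On the window `(n_j, n_j + 2π]` the lift of `e^{iθ}` is `gompfLift θ`. [folklore] -/
theorem modelG_exp {θ : ℝ} (h1 : nj < θ) (h2 : θ ≤ nj + 2 * π) :
    modelG a' b' nj (Circle.exp θ) = gompfLift a' b' θ := by
  rw [modelG, argCut_exp h1 h2]

/-- **Near the cut the lift is `0` above and `2π` below**: for `θ ∈ (n_j, a′]` (`-π < n_j`) it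
vanishes; for `θ ∈ (n_j - ?, n_j)` … precisely for `n_j - 2π + b′ ≤ θ' < n_j` hmm — we state the
two plateaus on the window: `θ ∈ (n_j, a′] → g̃ = 0` and `θ ∈ [b′, n_j + 2π] ∩ (n_j, n_j + 2π] → g̃ = 2π`
(with `0 < a′ < b′ < π`, `-π < n_j < a′`). [folklore] -/
theorem modelG_exp_of_le (hab : a' < b') (hb : b' < π) (hnj : -π < nj) {θ : ℝ}
    (h1 : nj < θ) (h2 : θ ≤ a') : modelG a' b' nj (Circle.exp θ) = 0 := by
  rw [modelG_exp h1 (by linarith), gompfLift_eq_zero hab hb (by linarith) h2]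

/-- The upper plateau: for `b′ ≤ θ ≤ n_j + 2π` (and `n_j < θ`), `g̃ = 2π`. [folklore] -/
theorem modelG_exp_of_ge (ha : 0 < a') (hab : a' < b') (hb : b' < π) (hnj : nj < 0) {θ : ℝ}
    (h0 : nj < θ) (h1 : b' ≤ θ) (h2 : θ ≤ nj + 2 * π) : modelG a' b' nj (Circle.exp θ) = 2 * π := by
  rw [modelG_exp h0 h2, gompfLift_eq_two_pi ha hab hb h1 (by linarith)]

/-- The lift is smooth off the cut point. [folklore] -/
theorem contMDiffAt_modelG (ha : 0 < a') (hab : a' < b') (hb : b' < π) {z : Circle}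
    (hz : (z : ℂ) * exp (-((nj + π : ℝ) : ℂ) * I) ∈ slitPlane) :
    ContMDiffAt (𝓡 1) 𝓘(ℝ, ℝ) ∞ (modelG a' b' nj) z :=
  (contDiff_gompfLift ha hab hb).contDiffAt.comp_contMDiffAt (contMDiffAt_argCut hz)

end Triv

end Literature.Topology.FourManifolds
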